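import Summits.BirchSwinnertonDyer.Rank1Residual.Additive.SharpenedStatements
import Summits.BirchSwinnertonDyer.Rank1Residual.Additive.PotGoodOrdinary
import HarnessLib
import HarnessLib.Audit.Tags

/-!
# Class O6 (WILD additive `p = 3`): the sub-partition by Kraus's inertia classification at `3`, and the wild analogue `(G₉)` of Delbourgo's (G) (cell `b2b-bsdres`, lane CLASS-CLOSURE, seat cc-typer-5)

HONEST FRAMING (cell `b2b-bsdres`, run/shared/lean/b2b/bsd-rank1-residual/, verbatim in every
file): the goal of the cell is to DELETE the COMBINATION-SHAPED residual classes of the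
Birch–Swinnerton-Dyer formula for ALL analytic-rank `≤ 1` elliptic curves over `ℚ` — "full BSD
formula for every rank `≤ 1` curve in class `C`" assembled STRICTLY from published theorems — so
that the rank-`≤ 1` remainder becomes exactly the CONSTRUCTION-SHAPED classes, which are TYPED
(missing-input `Prop`s), NOT attempted. This is not "finishing BSD". Lane CLASS-CLOSURE
(coordinator ruling 2026-08-21T04:07:19Z; `CLASS-CLOSURE-PLAN.md` §3.4: "O6 — X3 ∪ X4, WILD
`p = 3` (`v₃(N) ∈ {3,4,5}`): nothing formulated … E2: census by wild conductor exponent /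
semistability defect / field of good reduction degree (6, 12, …): sub-class 'potentially good
over an explicit sextic/duodecic field with cyclic inertia' as the first formulation target"):
research route; no claim beyond the stated class; nothing asserted; no label moves; nothing booked.

The class O6 is the census cell `(w)` = `SubW W 3` (`ord₃ j ≥ 0 ∧ f₃ ≠ 2`,
`Additive/SharpenedStatements.lean`) on the odd additive locus (`ClassO6` of
`Additive/PotSupersingularClasses.lean`: `p ≠ 2 ∧ Addv W p ∧ SubW W p`, which forces `p = 3`;
S-b: X4 `60 568` pairs (`r0/r1` `55 220/5 348`) + X3 `18 852` (`9 476/9 376`), two-engine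
`b2b-bsdres-rmap-2/census/addsplit_rmap2.md`). This file types its E2 SUB-PARTITION
(deliverable (b) of the lane) by the ORDER OF THE INERTIA GROUP `Φ = Gal(L/ℚ₃^nr)` of the minimal
extension `L = ℚ₃^nr(E[2], Δ^{1/4})` over which `E` acquires good reduction — A. Kraus, Manuscripta
Math. 69 (1990) 353–385, Théorème for `p = 3` (restated and used by N. Coppola, *Wild Galois
representations: elliptic curves over a 3-adic field*, Acta Arith. (2020) = arXiv:1812.05651,
Lemma 2.6 + Thm. 2.7, page-read chunk p0006 of the held text): for `E/ℚ₃` with potentially good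
reduction (`ord₃ j ≥ 0`) and minimal discriminant `Δ`,
  * type `I₀*` ⟹ `v(Δ) = 6`, `Φ ≅ C₂`;   type `III` ⟹ `v(Δ) = 3`, `Φ ≅ C₄`;   type `III*` ⟹ `v(Δ) = 9`, `Φ ≅ C₄`;
  * otherwise: `v(Δ) ≡ 0 (mod 4)` ⟹ `Φ ≅ C₃`;  `v(Δ) ≡ 2 (mod 4)` ⟹ `Φ ≅ C₆`;  `v(Δ)` odd ⟹ `Φ ≅ C₃ ⋊ C₄`
    (the dicyclic group of order `12`).
Since the Swan conductor at `3` vanishes iff `3 ∤ #Φ`, the TAME potentially good types at `3` are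
exactly `I₀*` (`e = 2`: the cell (G) = `SubGordTwo`, `subGordTwo_three_iff_typeG`) and `III`, `III*`
(`e = 4 ∤ 3 − 1`: the cell (t′) at `3`), and the WILD cell `(w)` is `{II, IV, IV*, II*}` with
`#Φ ∈ {3, 6, 12}` read off `v₃(Δ_min) mod 4` — DECIDABLE from Cremona's table (census columns
Kodaira symbol, `v₃(Δ)`; `CLASS-CLOSURE-PLAN.md` §3.4 ttrl2 line "I-9/I-4 join").

Contents (definitions + propositional bookkeeping; NO named fact — Kraus's theorem is the
DICTIONARY of the docstrings, cited, not vendored; a Literature fact `Kraus1990.…` linking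
`krausInertiaOrderThree` to `[L : ℚ₃^nr]` and to good reduction after base change — the `p = 3`
twin of additive-p2's PROVED `semistabilityIndex_dvd_ramificationIdx_of_hasGoodReductionAt`
(`p ≥ 5`) — is the natural prover item and is NOT introduced here):
* `krausInertiaOrderThree W : ℕ` — Kraus's table on `(W.kodairaSymbolAt (placeOf 3), v₃(Δ_min))`;
* `SubWCyclic W` (`(w)` ∧ `v₃(Δ_min)` even: `Φ ∈ {C₃, C₆}`, good reduction over a CYCLIC — cubic or
  sextic — totally ramified extension of `ℚ₃^nr`: the plan's "explicit sextic field with cyclic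
  inertia") and `SubWDicyclic W` (`(w)` ∧ `v₃(Δ_min)` odd: `Φ ≅ C₃ ⋊ C₄`, non-abelian inertia, good
  reduction only over a degree-`12` extension: the IRREDUCIBLE wild residue), with
  `subW_three_iff_cyclic_or_dicyclic` / `subWCyclic_disjoint_dicyclic` (no pair lost or doubled);
* `TypeGNine W` — **(G₉)**, the wild analogue of Delbourgo's (G) (`TypeG W p`: good reduction over a
  subfield of `ℚ(ζ_p)`): good reduction of `E_F` above `3` for some subfield `F ⊆ ℚ(ζ₉)`. Since
  `Gal(ℚ₃(ζ₉)/ℚ₃) ≅ C₆` is totally ramified with subextensions of degree `1, 2, 3, 6`, `(G₉)` pairs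
  have `Φ` CYCLIC of order `∣ 6`, i.e. `(G₉) ∩ (w) ⊆ SubWCyclic` — the converse fails (a cyclic cubic
  inertia character need not be the cyclotomic one; decidable per curve by Tate's algorithm over
  `ℚ(ζ₉)⁺ = ℚ(2cos(2π/9))`, a census bit to be added). `(G₉)` is the "first formulation target"
  of the plan: over `K_n = ℚ(ζ_{3^{n+1}})`, `n ≥ 1`, such an `E` HAS good supersingular reduction, so
  Kobayashi-type signed Selmer conditions along `ℚ(ζ_{3^∞})/ℚ(ζ₉)` and Delbourgo's construction
  ("semi-stable reduction over a cyclotomic extension of `ℚ_p`", Compositio 113 abstract) are the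
  neighbouring objects; Delbourgo p. 152: outside (G) "twisting by one-dimensional representations
  will not give us any inertia invariant subspace at `p`, so the method presented here cannot cope".
* conjecture slots `O6SharpCyclic`, `O6SharpDicyclic`, `O6SharpGNine` (class-restricted
  `MissingPPartAt`, OPEN, `@[conjecture]`) and `o6SharpW_iff` : the (w)-conjecture at `3` ⟺
  cyclic ∧ dicyclic parts. The uniform in-print antecedent (Kato, Astérisque 295 Conj. 12.10, no
  reduction hypothesis) and the Kato reduction to the LOWER half on `X4 ∩ r = 0 ∩ (12.5.2)` are
  recorded in `Additive/PotSupersingularTargets.lean`.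

References: A. Kraus, Manuscripta Math. 69 (1990) 353–385 [Kraus1990]; N. Coppola, Acta Arith. 195
(2020) 289–303 = arXiv:1812.05651, Lemma 2.6, Thm. 2.7 [Coppola2020] (held: `paper:arxiv-1812.05651` p0005–p0006);
J.-P. Serre, J. Tate, Ann. of Math. 88 (1968) §2 (`L = K^nr(E[m])`); D. Delbourgo, Compositio Math. 113
(1998) abstract, §1.5 (G), p. 152 [Delbourgo1998]; S. Kobayashi, Invent. Math. 152 (2003) §2
[Kobayashi2003]; RESIDUAL-MAP.md §I O6; CLASS-CLOSURE-PLAN.md §3.4; HOME/class-closure/O6/TYPED.md.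
-/

noncomputable section

open scoped Classical NumberField

open WeierstrassCurve IsDedekindDomain NumberField Literature.NumberTheory.EllipticCurves
  Literature.NumberTheory.EllipticCurves.Rank1Residual
  Literature.NumberTheory.EllipticCurves.Rank1Residual.Typed
  Literature.NumberTheory.DiophantineGeometry

namespace Summit.BirchSwinnertonDyer.Rank1Residual.Additive

section Kraus

variable (W : WeierstrassCurve ℚ) [W.IsElliptic] [W.IsGloballyMinimal]

/-- **Kraus's inertia order at `3`** — the order of `Φ = Gal(L/ℚ₃^nr)`, `L` the minimal extension of
`ℚ₃^nr` over which `E` acquires good reduction, READ OFF the Kodaira symbol at `3` and `v₃(Δ_min)`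
by Kraus's `p = 3` table (module docstring): `I₀* ↦ 2`, `III, III* ↦ 4`, otherwise
`v₃(Δ) ≡ 0 (4) ↦ 3`, `v₃(Δ) ≡ 2 (4) ↦ 6`, `v₃(Δ)` odd `↦ 12`. Meaningful on the potentially good
additive locus at `3` (`Addv W 3 ∧ ord₃ j ≥ 0`); junk elsewhere (good/multiplicative/potentially
multiplicative `3`), where nothing reads it. The `p = 3` companion of the census's
`semistabilityIndex` (`= #Φ` only for `p ≥ 5`, `SharpenedStatements.lean`). A definition by table;
the theorem "`= [L : ℚ₃^nr]`" is Kraus's and is NOT asserted here.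
[cite: Kraus1990, Théorème (p = 3)] [cite: Coppola2020, Lemma 2.6 and Thm. 2.7] -/
def krausInertiaOrderThree : ℕ :=
  match W.kodairaSymbolAt (placeOf 3) with
  | .Istar 0 => 2
  | .III => 4
  | .IIIstar => 4
  | _ =>
    if padicValInt 3 W.minimalDiscriminantInt % 4 = 0 then 3
    else if padicValInt 3 W.minimalDiscriminantInt % 2 = 0 then 6 else 12

/-- **O6, cyclic-inertia part** (`Φ ∈ {C₃, C₆}`): the wild cell (w) at `3` with `v₃(Δ_min)` EVEN —
by Kraus's table (types `II, IV, IV*, II*` only occur in (w), where `I₀*/III/III*` are excluded by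
tameness) `Φ ≅ C₃` (`v ≡ 0 mod 4`) or `C₆` (`v ≡ 2 mod 4`): `E` acquires good (supersingular)
reduction over a CYCLIC cubic or sextic totally ramified extension of `ℚ₃^nr` — the plan's
sub-class "potentially good over an explicit sextic field with cyclic inertia", first formulation
target. Contains `(G₉) ∩ (w)` (`TypeGNine`). A census-decidable predicate; nothing asserted.
[cite: Kraus1990, Théorème (p = 3)] [cite: Coppola2020, Thm. 2.7] -/
def SubWCyclic : Prop := SubW W 3 ∧ Even (padicValInt 3 W.minimalDiscriminantInt)

/-- **O6, dicyclic-inertia part** (`Φ ≅ C₃ ⋊ C₄`, order `12`, non-abelian): the wild cell (w) at `3`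
with `v₃(Δ_min)` ODD (types `II, IV, IV*, II*` with odd valuation; Kraus). Good reduction only over a
degree-`12` extension of `ℚ₃^nr` with non-abelian Galois group; no abelian (in particular no
cyclotomic) base change semistabilises `E` at `3`. The IRREDUCIBLE wild residue, named for
ideation. A census-decidable predicate; nothing asserted.
[cite: Kraus1990, Théorème (p = 3)] [cite: Coppola2020, Thm. 2.7] -/
def SubWDicyclic : Prop := SubW W 3 ∧ Odd (padicValInt 3 W.minimalDiscriminantInt)

/-- **The wild cell at `3` is the disjoint union of its cyclic and dicyclic parts** (parity of
`v₃(Δ_min)`): no pair lost. [folklore] -/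
theorem subW_three_iff_cyclic_or_dicyclic : SubW W 3 ↔ SubWCyclic W ∨ SubWDicyclic W := by
  unfold SubWCyclic SubWDicyclic
  rcases Nat.even_or_odd (padicValInt 3 W.minimalDiscriminantInt) with h | h <;> tauto

/-- No pair counted twice. [folklore] -/
theorem subWCyclic_disjoint_dicyclic : SubWCyclic W → ¬ SubWDicyclic W := fun hc hd ↦
  (Nat.not_even_iff_odd.mpr hd.2) hc.2

omit [W.IsElliptic] in
/-- On the cyclic part Kraus's order is `3` or `6`; on the dicyclic part it is `12` — PROVIDED the
Kodaira symbol at `3` is one of the wild types `II, IV, IV*, II*` (which Kraus's theorem guarantees on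
(w); here taken as a hypothesis, since the tree's Tate-algorithm facts at `3` are not invoked).
[cite: Kraus1990, Théorème (p = 3)] -/
theorem krausInertiaOrderThree_of_wildType
    (hk : W.kodairaSymbolAt (placeOf 3) = .II ∨ W.kodairaSymbolAt (placeOf 3) = .IV ∨
      W.kodairaSymbolAt (placeOf 3) = .IVstar ∨ W.kodairaSymbolAt (placeOf 3) = .IIstar) :
    (Even (padicValInt 3 W.minimalDiscriminantInt) →
      krausInertiaOrderThree W = 3 ∨ krausInertiaOrderThree W = 6) ∧
    (Odd (padicValInt 3 W.minimalDiscriminantInt) → krausInertiaOrderThree W = 12) := by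
  have hred : krausInertiaOrderThree W =
      (if padicValInt 3 W.minimalDiscriminantInt % 4 = 0 then 3
       else if padicValInt 3 W.minimalDiscriminantInt % 2 = 0 then 6 else 12) := by
    unfold krausInertiaOrderThree
    rcases hk with h | h | h | h <;> rw [h]
  refine ⟨fun he ↦ ?_, fun ho ↦ ?_⟩
  · rw [hred]
    have h2 : padicValInt 3 W.minimalDiscriminantInt % 2 = 0 := Nat.even_iff.mp he
    by_cases h4 : padicValInt 3 W.minimalDiscriminantInt % 4 = 0
    · simp [h4]
    · simp [h4, h2]
  · rw [hred]
    have h2 : padicValInt 3 W.minimalDiscriminantInt % 2 = 1 := Nat.odd_iff.mp ho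
    have h4 : padicValInt 3 W.minimalDiscriminantInt % 4 ≠ 0 := by omega
    simp [h4, h2]

end Kraus

/-! ### The wild analogue `(G₉)` of Delbourgo's hypothesis (G) -/

/-- **Hypothesis (G₉)** — the wild analogue at `3` of Delbourgo's (G) (`TypeG W p`: "`E` possesses
good reduction over a field `L ⊂ ℚ_p(μ_p)`", Compositio 113 §1.5), global transcription as in
`PotGoodOrdinary.lean`: for some `9`-th cyclotomic field `L ⊇ ℚ` and some intermediate field
`F ⊆ L`, the base change `E_F` has good reduction at every place of `F` above `3`. (`ℚ(ζ₉)/ℚ` is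
cyclic of degree `6`, totally ramified at `3`, so this is the local statement "good reduction over a
subfield of `ℚ₃(μ₉)`"; it contains (G) at `3` = `TypeG W 3` because `ℚ(ζ₃) ⊂ ℚ(ζ₉)`.) On the wild
cell such an `E` has CYCLIC inertia of order `3` or `6` (`⊆ SubWCyclic`), and over
`K_n = ℚ(ζ_{3^{n+1}})`, `n ≥ 1`, GOOD SUPERSINGULAR reduction above `3` — the setting in which
Delbourgo's construction ("semi-stable reduction over a cyclotomic extension of `ℚ_p`") and
Kobayashi's signed conditions along `ℚ(ζ_{3^∞})` are the neighbouring objects. A predicate on `W`;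
nothing asserted; a census bit (Tate's algorithm over `ℚ(ζ₉)⁺`) not yet tabulated.
[cite: Delbourgo1998, §1.5 (G) and p. 152] -/
def TypeGNine (W : WeierstrassCurve ℚ) : Prop :=
  ∃ (L : Type) (_ : Field L) (_ : NumberField L) (_ : IsCyclotomicExtension {9} ℚ L)
    (F : IntermediateField ℚ L),
    ∀ w : HeightOneSpectrum (𝓞 F), (3 : 𝓞 F) ∈ w.asIdeal → (W.baseChange F).HasGoodReductionAt w

/-! ### Conjecture slots on the wild cell (OPEN — `def`s, never asserted) -/

/-- **O6♯(w, cyclic)**: on the cyclic-inertia part of the wild cell at `3` (both X3 and X4 pairs,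
`r_an ≤ 1`), `ord₃ #Ш(E) = ord₃ #Ш_an(E)` (`Typed.MissingPPartAt`). The "verbatim-extension"
candidate of O6 (CLASS-CLOSURE-PLAN §3.4 E2). OPEN; nothing asserted; census evidence to be
attached by the lane's E1 experiment X4 third leg (cp-bsd-w4, `754` wild rows `N ≤ 3 000`).
[folklore] -/
@[conjecture] def O6SharpCyclic : Prop :=
  ∀ (W : WeierstrassCurve ℚ) [W.IsElliptic] [W.IsGloballyMinimal],
    W.analyticRank ≤ 1 → Addv W 3 → SubWCyclic W → MissingPPartAt W 3

/-- **O6♯(w, dicyclic)**: on the dicyclic-inertia part (`Φ ≅ C₃ ⋊ C₄`) of the wild cell at `3`,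
`ord₃ #Ш(E) = ord₃ #Ш_an(E)`. The IRREDUCIBLE wild residue (no abelian semistabilising base
change); in print only as Kato's reduction-free Conj. 12.10 for `(f_E, 3)`. OPEN; nothing asserted.
[folklore] -/
@[conjecture] def O6SharpDicyclic : Prop :=
  ∀ (W : WeierstrassCurve ℚ) [W.IsElliptic] [W.IsGloballyMinimal],
    W.analyticRank ≤ 1 → Addv W 3 → SubWDicyclic W → MissingPPartAt W 3

/-- **O6♯(G₉)**: on the wild pairs with good reduction attained inside `ℚ(ζ₉)` — the plan's FIRST
FORMULATION TARGET (signed Selmer conditions after base change to the field of good supersingular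
reduction `ℚ(ζ₉) ⊂ ℚ(ζ_{3^∞})`). OPEN; nothing asserted. [folklore] -/
@[conjecture] def O6SharpGNine : Prop :=
  ∀ (W : WeierstrassCurve ℚ) [W.IsElliptic] [W.IsGloballyMinimal],
    W.analyticRank ≤ 1 → Addv W 3 → SubW W 3 → TypeGNine W → MissingPPartAt W 3

/-- **The (w)-conjecture at `3` is exactly the conjunction of its cyclic and dicyclic parts** (no pair
lost, none doubled). The left side is the `p = 3` body of `O6Sharp` of
`Additive/PotSupersingularTargets.lean` (`ClassO6 W p` forces `p = 3`) and, on X3, of the hyp seat's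
`X3SharpW`. [folklore] -/
theorem o6SharpW_iff :
    (∀ (W : WeierstrassCurve ℚ) [W.IsElliptic] [W.IsGloballyMinimal],
        W.analyticRank ≤ 1 → Addv W 3 → SubW W 3 → MissingPPartAt W 3) ↔
      O6SharpCyclic ∧ O6SharpDicyclic := by
  constructor
  · intro h
    exact ⟨fun W _ _ hr hadd hc ↦ h W hr hadd hc.1, fun W _ _ hr hadd hd ↦ h W hr hadd hd.1⟩
  · rintro ⟨hc, hd⟩ W _ _ hr hadd hW
    rcases (subW_three_iff_cyclic_or_dicyclic W).mp hW with h | h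
    · exact hc W hr hadd h
    · exact hd W hr hadd h

/-- The cyclic-part conjecture contains the `(G₉)` target on the cyclic rows (bookkeeping: `(G₉)` is
a sub-condition; the inclusion `(G₉) ∩ (w) ⊆ cyclic` itself is Kraus + local class field theory and
is NOT asserted here, so the hypothesis `SubWCyclic` is kept explicitly). [folklore] -/
theorem o6SharpGNine_cyclicRows_of_o6SharpCyclic (h : O6SharpCyclic)
    (W : WeierstrassCurve ℚ) [W.IsElliptic] [W.IsGloballyMinimal] (hr : W.analyticRank ≤ 1)
    (hadd : Addv W 3) (hc : SubWCyclic W) (_hG : TypeGNine W) : MissingPPartAt W 3 :=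
  h W hr hadd hc

/-- **X3♯(w) is the X3 part of the (w)-conjecture at `3`**: the hyp seat's `X3SharpW` quantifies over
all primes `p` with `ClassX3 W p ∧ SubW W p`; at `p ≥ 5` the cell (w) is empty on the additive locus
(`DictionaryUniform.not_subW_of_addv_of_five_le`), so only `p = 3` matters — recorded here in the
`p = 3` form as an implication. [folklore] -/
theorem x3SharpW_three_of_cyclic_dicyclic (hc : O6SharpCyclic) (hd : O6SharpDicyclic)
    (W : WeierstrassCurve ℚ) [W.IsElliptic] [W.IsGloballyMinimal] (hr : W.analyticRank ≤ 1)
    (hX : ClassX3 W 3) (hW : SubW W 3) : MissingPPartAt W 3 :=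
  (o6SharpW_iff.mpr ⟨hc, hd⟩) W hr hX.2 hW

end Summit.BirchSwinnertonDyer.Rank1Residual.Additive

end
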